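import Literature.AlgebraicGeometry.Modules.DeligneSheafHomSections
import Literature.AlgebraicGeometry.Modules.IsoOfFrames
import Literature.AlgebraicGeometry.Modules.IdealSheafNoetherian
import Mathlib.AlgebraicGeometry.Morphisms.Separated
import HarnessLib

/-!
# The Deligne homomorphism of a section over `X ∖ V(𝓘)`, III: gluing on a Noetherian separated scheme

Sequel of `Modules/DeligneSheafHomAffine`, `Modules/DeligneSheafHomSections` (Hartshorne III Ex. 3.7
(a) / II Ex. 5.15; EGA I (1971) 6.9.17 "Deligne's formula" `Γ(W, M) = lim→ Hom(𝓘ⁿ, M)`, existence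
half, for affine-localizing `M` WITH torsion). On a Noetherian separated scheme `X`, for an open `W`
with ideal sheaf `𝓘` of `X ∖ W` and `Eₙ = 𝓘ⁿ𝒪_X` (`powIdealModule W n`):

* **`exists_hom_app_eq`** — for `M` affine-localizing and `s ∈ Γ(W, M)` there are `n`, a morphism of
  `𝒪_X`-modules `φ : Eₙ ⟶ M` and `e ∈ Γ(W, Eₙ)` (the unit section `1_W`) with `φ(e) = s`.
  Proof: representing morphisms `Eₙ|_V ⟶ M|_V` on the members of a finite affine cover
  (`exists_representsHom`), raised to a common exponent, agree on the AFFINE pairwise intersections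
  (`X` separated) after raising the exponent once more (`exists_forall_evalHom_eq_of_representsHom`,
  `representsHom_restrictHom`), hence glue (`glueHom`, `Modules/SheafHom`) to `Eₙ|_⊤ ⟶ M|_⊤`, i.e.
  to `Eₙ ⟶ M` (`homOfTop`, `Modules/IsoOfFrames`); the value on `1_W` is `s` by descent of the
  representation to the opens `V ∩ W` and the sheaf property of `M`.

Consumer: `Morphisms/CechCocycleCoherentSubmodule` (every Čech cocycle of an affine-localizing module
lies in a coherent submodule; cell res-hironaka, route (δ) of F-53, step S8). Everything is proved;
no named facts.

## References

* R. Hartshorne, *Algebraic Geometry*, GTM 52 (1977): II Ex. 5.15, III Ex. 3.7 (a). [Hartshorne1977]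
* A. Grothendieck, J. Dieudonné, EGA I (Springer 1971), 6.9.17.
-/

noncomputable section

-- `TopCat.Presheaf`/`Scheme.Modules` are not reducible (as in Mathlib's `AlgebraicGeometry/Modules`).
set_option backward.isDefEq.respectTransparency false

open CategoryTheory AlgebraicGeometry Limits TopologicalSpace Opposite
open Literature.AlgebraicGeometry.Morphisms Literature.AlgebraicGeometry.Motives

universe u

namespace Literature.AlgebraicGeometry.Modules

variable {X : Scheme.{u}}

/-! ## Global gluing on a Noetherian separated scheme -/

section Global

/-- Restricting twice is restricting once (sections of `M`). [folklore] -/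
private theorem mmap_mmap (M : X.Modules) {A B C : X.Opens} (h1 : B ≤ A) (h2 : C ≤ B) (m : Γ(M, A)) :
    M.presheaf.map (homOfLE h2).op (M.presheaf.map (homOfLE h1).op m) =
      M.presheaf.map (homOfLE (h2.trans h1)).op m := by
  rw [map_map]
  exact map_eq_map M _ _ m

/-- Restricting twice is restricting once (functions). [folklore] -/
private theorem xmap_xmap {A B C : X.Opens} (h1 : B ≤ A) (h2 : C ≤ B) (r : Γ(X, A)) :
    X.presheaf.map (homOfLE h2).op (X.presheaf.map (homOfLE h1).op r) =
      X.presheaf.map (homOfLE (h2.trans h1)).op r := by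
  rw [← CategoryTheory.comp_apply, ← Functor.map_comp]
  rfl

variable (W : X.Opens)

/-- For an affine `V ⊆ W`, `𝓘(V)` is the unit ideal. [folklore] -/
private theorem idealOfCompl_ideal_eq_top {V : X.Opens} (hV : IsAffineOpen V) (hVW : V ≤ W) :
    (idealOfCompl W).ideal ⟨V, hV⟩ = ⊤ := by
  have h1 := hV.fromSpec_image_zeroLocus ((idealOfCompl W).ideal ⟨V, hV⟩)
  have h2 : X.zeroLocus (U := V) ((idealOfCompl W).ideal ⟨V, hV⟩) ∩ V = ∅ := by
    have h3 := Scheme.IdealSheafData.coe_support_inter (idealOfCompl W) ⟨V, hV⟩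
    rw [Scheme.IdealSheafData.coe_support_vanishingIdeal] at h3
    rw [← h3]
    ext x
    simp only [Set.mem_inter_iff, Set.mem_empty_iff_false, iff_false, not_and]
    intro hx hxV
    exact hx (hVW hxV)
  have h4 : PrimeSpectrum.zeroLocus (((idealOfCompl W).ideal ⟨V, hV⟩ : Ideal Γ(X, V)) : Set Γ(X, V))
      = ∅ := by
    have := h1.trans_subset (h2.le)
    simpa only [Set.subset_empty_iff, Set.image_eq_empty] using this
  exact PrimeSpectrum.zeroLocus_empty_iff_eq_top.mp h4


/-- **The unit section `1_W ∈ Γ(W, 𝓘ⁿ𝒪_X)`** (`𝓘ⁿ𝒪_X|_W = 𝒪_W`). [folklore] -/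
private theorem exists_secFun_eq_one (n : ℕ) : ∃ e : Γ(powIdealModule W n, W), secFun n e = 1 := by
  have h1 : IsIdealMulSection (unitModule X) (idealOfCompl W ^ n) W
      (show Γ(unitModule X, W) from (1 : Γ(X, W))) := by
    intro x hx
    obtain ⟨V, hV, hxV, hVW⟩ := Opens.isBasis_iff_nbhd.mp X.isBasis_affineOpens hx
    refine ⟨⟨V, hV⟩, hVW, hxV, ?_⟩
    rw [Scheme.IdealSheafData.ideal_pow, Pi.pow_apply, idealOfCompl_ideal_eq_top W hV hVW,
      Ideal.top_pow, Submodule.top_smul]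
    exact Submodule.mem_top
  obtain ⟨e, he⟩ := exists_idealMulι_app_eq (unitModule X) (idealOfCompl W ^ n) _ h1
  exact ⟨e, he⟩

/-- `powMono` composes: the underlying sections agree. [folklore] -/
private theorem powMono_app_powMono_app {n m k : ℕ} (h : n ≤ m) (h' : m ≤ k) {U : X.Opens}
    (e : Γ(powIdealModule W k, U)) :
    (powMono (W := W) h).app U ((powMono (W := W) h').app U e) = (powMono (W := W) (h.trans h')).app U e :=
  idealMulι_app_injective _ _ _ rfl

/-- Restriction of `f|_U` along `V ⟶ U` is `f|_V`. [folklore] -/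
private theorem restrictHom_over {E E' M : X.Modules} {U V : X.Opens} (i : V ⟶ U) (f : E' ⟶ E)
    (ψ : E.over U ⟶ M.over U) :
    restrictHom i (SheafOfModules.Hom.over f U ≫ ψ) = SheafOfModules.Hom.over f V ≫ restrictHom i ψ :=
  hom_ext_of_appLE fun _ _ _ => rfl

variable {W} {M : X.Modules} (s : Γ(M, W))

/-- **The Deligne homomorphism, globally** (existence half of Deligne's formula, Hartshorne III
Ex. 3.7 (a) / EGA I 6.9.17, for affine-localizing modules with torsion allowed): on a Noetherian
separated scheme, every section `s ∈ Γ(W, M)` of an affine-localizing `M` over an open `W` is the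
value `φ(e)` of a morphism `φ : 𝓘ⁿ𝒪_X ⟶ M` (`𝓘` the ideal sheaf of `X ∖ W`, `n ≫ 0`) on a section
`e` of `𝓘ⁿ𝒪_X` over `W` (namely `e = 1_W`). Proof: representing morphisms on the members of a finite
affine cover (`exists_representsHom`) agree on the (affine) pairwise intersections after raising the
exponent (`exists_forall_evalHom_eq_of_representsHom`), hence glue (`Modules/SheafHom`).
[cite: Hartshorne1977, III Ex. 3.7 (a)] -/
theorem exists_hom_app_eq [IsNoetherian X] [X.IsSeparated] (hM : IsAffineLocalizing M) :
    ∃ (n : ℕ) (φ : powIdealModule W n ⟶ M) (e : Γ(powIdealModule W n, W)), φ.app W e = s := by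
  classical
  -- a finite affine cover
  obtain ⟨t, ht⟩ := exists_finite_affineOpens_iSup_eq_top (X := X)
  let V : t → X.Opens := fun a => ((a : X.affineOpens) : X.Opens)
  have hV : ∀ a, IsAffineOpen (V a) := fun a => (a : X.affineOpens).2
  have htop : (⨆ a, V a) = ⊤ := ht
  haveI : ∀ a, IsNoetherianRing Γ(X, V a) := fun a =>
    IsLocallyNoetherian.component_noetherian (a : X.affineOpens)
  -- representing morphisms on the members, with a common exponent `n`
  have hex : ∀ a, ∃ (n : ℕ) (ψ : (powIdealModule W n).over (V a) ⟶ M.over (V a)),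
      RepresentsHom n s ψ := fun a => exists_representsHom (hV a) s hM
  choose n₀ ψ₀ hψ₀ using hex
  let n : ℕ := Finset.univ.sup n₀
  have hn : ∀ a, n₀ a ≤ n := fun a => Finset.le_sup (Finset.mem_univ a)
  let ψ₁ : ∀ a, (powIdealModule W n).over (V a) ⟶ M.over (V a) := fun a =>
    SheafOfModules.Hom.over (powMono (W := W) (hn a)) (V a) ≫ ψ₀ a
  have hψ₁ : ∀ a, RepresentsHom n s (ψ₁ a) := fun a => representsHom_powMono_comp (hn a) (hψ₀ a)
  -- agreement exponents on the affine pairwise intersections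
  have hVV : ∀ a b, IsAffineOpen (V a ⊓ V b) := fun a b => (hV a).inf (hV b)
  haveI : ∀ a b, IsNoetherianRing Γ(X, V a ⊓ V b) := fun a b =>
    IsLocallyNoetherian.component_noetherian ⟨_, hVV a b⟩
  have hagree : ∀ a b, ∃ c : ℕ, ∀ e : Γ(powIdealModule W (n + c), V a ⊓ V b),
      evalHom _ M (V a ⊓ V b) (restrictHom (Opens.infLELeft (V a) (V b)) (ψ₁ a))
          ((powMono (W := W) (Nat.le_add_right n c)).app _ e) =
        evalHom _ M (V a ⊓ V b) (restrictHom (Opens.infLERight (V a) (V b)) (ψ₁ b))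
          ((powMono (W := W) (Nat.le_add_right n c)).app _ e) := fun a b =>
    exists_forall_evalHom_eq_of_representsHom (hVV a b) hM
      (representsHom_restrictHom (hV a) _ (hψ₁ a)) (representsHom_restrictHom (hV b) _ (hψ₁ b))
  choose c hc using hagree
  let c₀ : ℕ := Finset.univ.sup fun p : t × t => c p.1 p.2
  have hcc : ∀ a b, c a b ≤ c₀ := fun a b =>
    Finset.le_sup (f := fun p : t × t => c p.1 p.2) (Finset.mem_univ (a, b))
  -- the family to be glued, at exponent `n' = n + c₀`
  let sf : ∀ a, (powIdealModule W (n + c₀)).over (V a) ⟶ M.over (V a) := fun a =>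
    SheafOfModules.Hom.over (powMono (W := W) (Nat.le_add_right n c₀)) (V a) ≫ ψ₁ a
  have hsf_rep : ∀ a, RepresentsHom (n + c₀) s (sf a) := fun a =>
    representsHom_powMono_comp _ (hψ₁ a)
  have hsf : ∀ a b, restrictHom (Opens.infLELeft (V a) (V b)) (sf a) =
      restrictHom (Opens.infLERight (V a) (V b)) (sf b) := by
    intro a b
    apply evalHom_injective (isAffineLocalizing_powIdealModule W (n + c₀)) (hVV a b)
    ext e
    have hle : n + c a b ≤ n + c₀ := Nat.add_le_add_left (hcc a b) n
    have key := hc a b ((powMono (W := W) hle).app _ e)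
    rw [powMono_app_powMono_app] at key
    simp only [sf, restrictHom_over]
    exact key
  -- glue and descend to a morphism of `𝒪_X`-modules
  let Ψ := glueHom V sf hsf
  let Ψtop : (powIdealModule W (n + c₀)).over ⊤ ⟶ M.over ⊤ :=
    restrictHom (homOfLE (htop.symm ▸ le_rfl : (⊤ : X.Opens) ≤ ⨆ a, V a)) Ψ
  let φ : powIdealModule W (n + c₀) ⟶ M := homOfTop Ψtop
  obtain ⟨e₁, he₁⟩ := exists_secFun_eq_one W (n + c₀)
  refine ⟨n + c₀, φ, e₁, ?_⟩
  -- `φ(1_W) = s`: check on the cover `V a ∩ W` of `W`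
  rw [← sub_eq_zero]
  refine section_eq_zero_of_locally M _ fun p hp => ?_
  obtain ⟨a, ha⟩ := Opens.mem_iSup.mp (show p ∈ ⨆ a, V a by rw [htop]; trivial)
  refine ⟨V a ⊓ W, inf_le_right, ⟨ha, hp⟩, ?_⟩
  rw [map_sub, sub_eq_zero]
  -- the value of `φ` on `e₁|_{V a ∩ W}` is that of `sf a`
  have hval : M.presheaf.map (homOfLE (inf_le_right : V a ⊓ W ≤ W)).op (φ.app W e₁) =
      appLE (sf a) (Opens.infLELeft (V a) W)
        ((powIdealModule W (n + c₀)).presheaf.map (homOfLE (inf_le_right : V a ⊓ W ≤ W)).op e₁) := by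
    rw [← Scheme.Modules.Hom.app_map_apply, homOfTop_app, appLE_restrictHom,
      ← restrictHom_glueHom V sf hsf a, appLE_restrictHom]
    exact appLE_congr_hom _ _ _ _
  rw [hval]
  -- `sf a` restricted to `V a ∩ W` represents `s` there, and `e₁|` has function `1`
  have hrep := representsHom_restrictHom (n := n + c₀) (s := s) (hV a) (Opens.infLELeft (V a) W)
    (hsf_rep a) ((powIdealModule W (n + c₀)).presheaf.map (homOfLE (inf_le_right : V a ⊓ W ≤ W)).op e₁)
  rw [evalHom_restrictHom_apply, secFun_map, he₁, map_one, map_one, one_smul] at hrep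
  -- un-restrict along `(V a ⊓ W) ⊓ W = V a ⊓ W`
  have hinj : ∀ z z' : Γ(M, V a ⊓ W),
      M.presheaf.map (homOfLE (inf_le_left : (V a ⊓ W) ⊓ W ≤ V a ⊓ W)).op z =
        M.presheaf.map (homOfLE (inf_le_left : (V a ⊓ W) ⊓ W ≤ V a ⊓ W)).op z' → z = z' := by
    intro z z' h
    have h' := congrArg (M.presheaf.map (homOfLE (le_inf le_rfl inf_le_right :
      V a ⊓ W ≤ (V a ⊓ W) ⊓ W)).op) h
    rwa [mmap_mmap, mmap_mmap, map_self, map_self] at h'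
  refine hinj _ _ ?_
  rw [hrep, mmap_mmap]

end Global

end Literature.AlgebraicGeometry.Modules

end
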